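import Summits.MatrixMultiplication.MatrixMultiplication.Theorems.AbelianSTPPCensusShapeCertDefs

/-!
# Abelian STPP census — kernel evaluation of the `ShapeCert` checker (F: orders 112, 113, 114, 115, 116, 117, 118, 119)

`check M = true` by `decide +kernel` (no `native_decide`), one theorem per order (per range of small orders),
so that every kernel run starts with empty caches and stays under the default heartbeat budget
(≈ 2–6 s per order below 100, up to ≈ 30 s at the orders 125 and 127).
Consumed by `…ShapeCertFinal` (`check_le_127`).
-/

set_option linter.dupNamespace false -- `MatrixMultiplication.MatrixMultiplication` (summit = problem, D-0017)
set_option autoImplicit false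

namespace Summit.MatrixMultiplication.MatrixMultiplication.Theorems.ShapeCert

/-- certificate check at order `112` (kernel evaluation) -/
theorem check_112 : check 112 = true := by decide +kernel

/-- certificate check at order `113` (kernel evaluation) -/
theorem check_113 : check 113 = true := by decide +kernel

/-- certificate check at order `114` (kernel evaluation) -/
theorem check_114 : check 114 = true := by decide +kernel

/-- certificate check at order `115` (kernel evaluation) -/
theorem check_115 : check 115 = true := by decide +kernel

/-- certificate check at order `116` (kernel evaluation) -/
theorem check_116 : check 116 = true := by decide +kernel

/-- certificate check at order `117` (kernel evaluation) -/
theorem check_117 : check 117 = true := by decide +kernel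

/-- certificate check at order `118` (kernel evaluation) -/
theorem check_118 : check 118 = true := by decide +kernel

/-- certificate check at order `119` (kernel evaluation) -/
theorem check_119 : check 119 = true := by decide +kernel

end Summit.MatrixMultiplication.MatrixMultiplication.Theorems.ShapeCert
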